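import Mathlib
import Summits.ValiantsHypothesis.ValiantsHypothesis.Theorems.GrenetZeonTwoDimCoefficientsStubClassify
import HarnessLib

/-!
# Crux `GrenetZeon.PolySizeQPAlgebra` (stmt-ValiantsHypothesis-8064), line `vbp-slice-dealg` —
# TRANSPORT of a curvilinear piece `λ(det_R A)`, `R ⊇ (1, e, …, e^{r-1})`, to jet currency

`…JetHessian` / `…JetRungs` bound and exclude JET FORMS `Σ_{j<r} λ_j [t^j] det M` of polynomial
matrices `M` over `S[t]`, `S = ℂ[x_σ]`.  This file supplies the dictionary from the route's
coefficient-algebra currency: if a commutative `ℂ`-algebra `R` has a basis `(1, e, e², …, e^{r-1})` with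
`e^r = 0` (a CURVILINEAR algebra `ℂ[ε]/ε^r` — every local Frobenius algebra of dimension `≤ 3` is of
this form), then for every matrix `A` over `R[x_σ]` read through a functional `λ : R → ℂ` there is a
polynomial matrix `M` over `S[t]` — entry `(i,k)` is `Σ_{j<r} t^j · (e^j-coordinate of A_{ik})` — with

* `λ(det A) = Σ_{j<r} λ(e^j) · [t^j] det M` coefficientwise (`exists_jet_form_of_basis_pow`), because the
  substitution `t ↦ e` (with `ℂ ⊆ R` on coefficients) maps `M` to `A`, hence `det M` to `det A`, and
  `e^j = 0` for `j ≥ r`;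
* the coefficient matrices `[t^a] M` are coordinate projections of `A`: their total degrees do not
  exceed those of `A`, and they consist of linear forms when `A` does.

No new definitions (the coordinate projection `p ↦ Σ_{d ∈ supp p} coord_j(p_d) x^d` of
`…StubClassify` is used inline).  HONEST FRAMING: bookkeeping for the conditional rung `(n, 3)`;
nothing here is progress on VP ≠ VNP by itself.

References: P. Hrubeš, A. Yehudayoff, *Arithmetic complexity in ring extensions*, Theory of
Computing 7 (2011), §2 [HrubesYehudayoff2011].
-/

noncomputable section

open MvPolynomial Matrix

-- single-conjunct layout `Summits/ValiantsHypothesis/ValiantsHypothesis`: duplicated namespace by design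
set_option linter.dupNamespace false

namespace Summit.ValiantsHypothesis.ValiantsHypothesis.Theorems.GrenetZeonPolySizeQPAlgebra

open Summit.ValiantsHypothesis.ValiantsHypothesis.Cruxes.TwoDimCoefficients.DimTwoCases
  (coeff_sum_monomial_support totalDegree_sum_monomial_support_le)

universe v

variable {σ : Type v} {R : Type*} [CommRing R] [Algebra ℂ R]

omit [Algebra ℂ R] in
/-- The coordinate projection `p ↦ Σ_{d ∈ supp p} ψ(p_d) x^d` of a form of degree `N` is a form of
degree `N`. [folklore] -/
theorem isHomogeneous_sum_monomial_support (ψ : R → ℂ) {p : MvPolynomial σ R} {N : ℕ}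
    (hp : p.IsHomogeneous N) :
    (∑ d' ∈ p.support, monomial d' (ψ (p.coeff d'))).IsHomogeneous N := by
  classical
  refine IsHomogeneous.sum _ _ _ fun d' hd' => isHomogeneous_monomial _ ?_
  rw [Finsupp.degree_eq_weight_one]
  exact hp (mem_support_iff.1 hd')

/-- Substituting `t ↦ e` after `ℂ ⊆ R`: the value of `λ` on a coefficient of the image of a polynomial
`P ∈ S[t]` is `Σ_{j<r} λ(e^j) · (coefficient of [t^j] P)` when `e^r = 0`. [folklore] -/
theorem apply_coeff_eval₂_C_eq_sum {r : ℕ} (e : R) (he : e ^ r = 0) (l : R →ₗ[ℂ] ℂ)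
    (P : Polynomial (MvPolynomial σ ℂ)) (d : σ →₀ ℕ) :
    l (coeff d (Polynomial.eval₂RingHom (MvPolynomial.map (algebraMap ℂ R)) (C e) P)) =
      ∑ j ∈ Finset.range r, l (e ^ j) * coeff d (P.coeff j) := by
  classical
  set g : ℕ → ℂ := fun j => l (e ^ j) * coeff d (P.coeff j) with hg
  -- the image, coefficientwise
  have h1 : l (coeff d (Polynomial.eval₂RingHom (MvPolynomial.map (algebraMap ℂ R)) (C e) P)) =
      ∑ j ∈ P.support, g j := by
    rw [Polynomial.coe_eval₂RingHom, Polynomial.eval₂_eq_sum, Polynomial.sum_def, coeff_sum, map_sum]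
    refine Finset.sum_congr rfl fun j _ => ?_
    rw [← map_pow, mul_comm, coeff_C_mul, coeff_map, mul_comm, ← Algebra.smul_def, map_smul,
      smul_eq_mul, mul_comm]
  -- both sums are the sum of `g` over `supp P ∪ range r`
  have hvan1 : ∀ j ∈ P.support ∪ Finset.range r, j ∉ P.support → g j = 0 := by
    intro j _ hj
    rw [hg]
    simp only [Polynomial.notMem_support_iff.1 hj, coeff_zero, mul_zero]
  have hvan2 : ∀ j ∈ P.support ∪ Finset.range r, j ∉ Finset.range r → g j = 0 := by
    intro j _ hj
    have hrj : r ≤ j := by simpa using hj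
    rw [hg]
    simp only
    rw [show e ^ j = e ^ r * e ^ (j - r) by rw [← pow_add, Nat.add_sub_cancel' hrj], he, zero_mul,
      map_zero, zero_mul]
  rw [h1, Finset.sum_subset Finset.subset_union_left hvan1,
    ← Finset.sum_subset Finset.subset_union_right hvan2]

/-- **Transport of a curvilinear piece to jet currency.** Let `R` be a commutative `ℂ`-algebra with a
basis `b = (e^0, e^1, …, e^{r-1})` and `e^r = 0`, `λ : R → ℂ` linear, `A` a square matrix over `R[x_σ]`
and `F ∈ ℂ[x_σ]` with `λ(coeff_d det A) = coeff_d F` for all `d`.  Then there is a matrix `M` over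
`ℂ[x_σ][t]` whose coefficient matrices are coordinate projections of `A` — so `deg [t^a] M_{ik} ≤ deg A_{ik}`
and `[t^a] M_{ik}` is a form of degree `N` whenever `A_{ik}` is — with
`F = Σ_{j<r} λ(e^j) · [t^j] det M`. [cite: HrubesYehudayoff2011, §2] -/
theorem exists_jet_form_of_basis_pow {r m : ℕ} (e : R) (he : e ^ r = 0) (b : Module.Basis (Fin r) ℂ R)
    (hb : ∀ j : Fin r, b j = e ^ (j : ℕ)) (l : R →ₗ[ℂ] ℂ)
    (A : Matrix (Fin m) (Fin m) (MvPolynomial σ R)) (F : MvPolynomial σ ℂ)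
    (hF : ∀ d : σ →₀ ℕ, l (coeff d A.det) = coeff d F) :
    ∃ M : Matrix (Fin m) (Fin m) (Polynomial (MvPolynomial σ ℂ)),
      (∀ i k a, ((M i k).coeff a).totalDegree ≤ (A i k).totalDegree) ∧
      (∀ i k a N, (A i k).IsHomogeneous N → ((M i k).coeff a).IsHomogeneous N) ∧
      F = ∑ j ∈ Finset.range r, C (l (e ^ j)) * M.det.coeff j := by
  classical
  -- coordinate projections and the polynomial matrix
  set π : Fin r → MvPolynomial σ R → MvPolynomial σ ℂ := fun j p =>
    ∑ d' ∈ p.support, monomial d' (b.coord j (p.coeff d')) with hπ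
  set M : Matrix (Fin m) (Fin m) (Polynomial (MvPolynomial σ ℂ)) := Matrix.of fun i k =>
    ∑ j : Fin r, Polynomial.monomial (j : ℕ) (π j (A i k)) with hM
  have hMcoeff : ∀ i k a, (M i k).coeff a = if h : a < r then π ⟨a, h⟩ (A i k) else 0 := by
    intro i k a
    rw [hM, Matrix.of_apply, Polynomial.finsetSum_coeff]
    simp only [Polynomial.coeff_monomial]
    split_ifs with h
    · rw [Finset.sum_eq_single ⟨a, h⟩ (fun j _ hj => if_neg fun h' => hj (Fin.ext h')) (by simp),
        if_pos rfl]
    · exact Finset.sum_eq_zero fun j _ => if_neg fun h' => h (by rw [← h']; exact j.2)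
  -- the substitution `t ↦ e`
  set ι : MvPolynomial σ ℂ →+* MvPolynomial σ R := MvPolynomial.map (algebraMap ℂ R) with hι
  set Θ : Polynomial (MvPolynomial σ ℂ) →+* MvPolynomial σ R := Polynomial.eval₂RingHom ι (C e)
    with hΘ
  have hΘM : Θ.mapMatrix M = A := by
    ext i k d
    rw [RingHom.mapMatrix_apply, Matrix.map_apply, hM, Matrix.of_apply, map_sum, coeff_sum]
    have hterm : ∀ j : Fin r, coeff d (Θ (Polynomial.monomial (j : ℕ) (π j (A i k)))) =
        (if d ∈ (A i k).support then b.coord j ((A i k).coeff d) else 0) • e ^ (j : ℕ) := by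
      intro j
      rw [hΘ, Polynomial.coe_eval₂RingHom, Polynomial.eval₂_monomial, ← map_pow, mul_comm,
        coeff_C_mul, hι, coeff_map, hπ, coeff_sum_monomial_support, Algebra.smul_def, mul_comm]
    rw [Finset.sum_congr rfl fun j _ => hterm j]
    by_cases hd : d ∈ (A i k).support
    · simp only [if_pos hd]
      conv_rhs => rw [← b.sum_repr (coeff d (A i k))]
      exact Finset.sum_congr rfl fun j _ => by rw [hb j, Module.Basis.coord_apply]
    · simp only [if_neg hd, zero_smul, Finset.sum_const_zero]
      exact (notMem_support_iff.1 hd).symm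
  have hdet : A.det = Θ M.det := by
    rw [RingHom.map_det, hΘM]
  refine ⟨M, fun i k a => ?_, fun i k a N hN => ?_, ?_⟩
  · rw [hMcoeff]
    split_ifs with h
    · exact totalDegree_sum_monomial_support_le _ _
    · rw [totalDegree_zero]; exact Nat.zero_le _
  · rw [hMcoeff]
    split_ifs with h
    · exact isHomogeneous_sum_monomial_support _ hN
    · exact isHomogeneous_zero σ ℂ N
  · refine MvPolynomial.ext _ _ fun d => ?_
    rw [← hF d, hdet, hΘ, apply_coeff_eval₂_C_eq_sum e he l, coeff_sum]
    exact Finset.sum_congr rfl fun j _ => by rw [coeff_C_mul]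

end Summit.ValiantsHypothesis.ValiantsHypothesis.Theorems.GrenetZeonPolySizeQPAlgebra

end
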